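/-
b2b-lace packet, CARVER gen 27 (unit `b2b-lace-carver-g27`).  HOME/LEMMAS nodes D10H-2k-S + D10H-2k-Q (children of D10H-2k-T, p215181):
the `W_d`-SYMMETRY, SHELL / `Q` SPLIT, GENERIC-CELL and PER-CONE readings of the (3.87)-majorant `boundHD75` AT THE ALTERNATIVE TRUE TABLES
`srwTrueAlt d α̲ ᾱ` — the twins of tail-g9/g11's `F3BoundsCellSplit` §2 bis, §3 bis, §5 and `F3BoundsQCones` §4 (whose §1–§4 resp. §1–§3c
are table-free and are reused verbatim).  Additive; d-generic; no numeral of any dimension; no named fact; no dimension sentence.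
-/
import Literature.Probability.FitznerVanDerHofstad2017.F3BoundsQCones
import Literature.Probability.FitznerVanDerHofstad2017.NobleF3TrueTablesAlt
import HarnessLib

/-!
# Symmetry, shell/`Q` split and per-cone reading of the `f₃` numerator at the ALTERNATIVE true tables

CITATION HEADER (PLACEMENT v2). Part of a certified REPRODUCTION of R. Fitzner, R. van der Hofstad, *Generalized approach to the
non-backtracking lace expansion*, PTRF **169** (2017) 1041–1119 [NoBLE17], §3.3.4 (3.35)–(3.38) p. 1071 (the SRW tables are functions of
`|x_1|, …, |x_d|` up to permutation), §3.3.5 (3.61)–(3.64) pp. 1074–1076 and (3.71)–(3.87) pp. 1077–1079 (the bounds and the cells), §5.1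
p. 1093 (the far region `Q`), and of R. Fitzner, R. van der Hofstad, *Mean-field behavior for nearest-neighbor percolation in `d > 10`*,
EJP **22** (2017) no. 43 [FvdH17], (2.21)–(2.23), §2.5 (notebook `Percolation.nb`: `boundF3[k,o]`, `BoundFThreeBound[n,l,{{3},{1,1},{0,0,1}}]`):

> [NoBLE17] p. 1079: "the supremum over `S` is attained at one of the lowest-order points of `S`, as all involved functions are monotone
> decreasing in the absolute value of each coordinate"; p. 1071 (3.35)–(3.38): the tables depend on `x` through the SRW quantities only.

Every `[cite:]` tag below is a LOCATOR for comparison, not an appeal to authority: all statements are proved here from tree theorems.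
DIVERGENCE D80 (packet): the natural-row `IM` entry is the ALTERNATIVE one, `IM_alt = min (IM_print-shape, env)` (`NobleF3TrueTablesAlt`);
both arguments of the `min` are built from the `W_d`-invariant, `|x_j|`-antitone SRW quantities `𝒥`, `I`, `S`, so every symmetry / cone
statement of the printed-shape chain holds verbatim.

## What is here (all proved, `d`-generic)
§1 `srwEnvIM_spAct`, `srwTrueAlt_IM_spAct`, `srwTrueAlt_frozenAt_spAct`, **`boundHD75_srwTrueAlt_spAct`**, `spInvariant_boundHD75_srwTrueAlt`.
§2 `boundHD75_srwTrueAlt_shell_le` (the shell `‖x‖₁ = 2` from its two nodes), `boundHD75_srwTrueAlt_calX_le_of_nodes_of_Q`.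
§3 `F3Bounds.OnDomAlt d α̲ ᾱ C m l t` — per-entry domination ON A SET `C` under the alternative (majorants `J' I' S'` of `𝒥_{m+2,l}`,
   `I_{m+3,l}`, `S_{m+3,l}` on `C` with print's triple OR `env d J' I' S' α̲ ᾱ 1 2 ≤ t`), constructors, `srwTrueAlt_IM_natCast_le_of_onDomAlt`;
   the generic-cell theorems **`boundHD75_srwTrueAlt_zero_le_on`**, **`boundHD75_srwTrueAlt_one_le_on`** (twins of `boundHD75_srwTrue_{zero,one}_le_on`)
   and the at-a-node forms `boundHD75_srwTrueAlt_zero_at_le`, `boundHD75_srwTrueAlt_one_at_le` (entry hypotheses as `IM`-values, to be fed by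
   `srwTrueAlt_IM_natCast_le_of_printed` / `…_of_env_le` of `NobleF3TrueTablesAlt` §4).
§4 **`boundHD75_srwTrueAlt_three_le_of_absCones`**, `boundHD75_srwTrueAlt_three_le_iff_absCones`, **`boundHD75_srwTrueAlt_calX_le_of_nodes_of_absCones`**
   (twins of `F3BoundsQCones` §4: the three node cones of `Q` and the shell nodes give the cell on `Q` / on `𝒳`).

## What is NOT here
No dimension, no table, no numeric value, no certificate.  Heartbeat census (packet filing rule): every declaration is a rewrite along
invariance lemmas or a term-mode composition; nothing approaches 100 000; no option set.
-/

noncomputable section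

namespace Literature.Probability.FitznerVanDerHofstad2017

open Finset Real
open Literature.Barriers.CriticalPhenomena Literature.Probability.LatticeModels

namespace F3Bounds

variable {d : ℕ} {afmin afmax : ℝ}

/-! ### §1  `W_d`-invariance of `boundHD75` at the alternative true tables -/

/-- The corrected entry `srwEnvIM` is `W_d`-invariant in the node. [cite: FitznerVanDerHofstad2016NoBLE, §3.3.4 (3.35)–(3.38) p. 1071; §3.3.5 (3.61)–(3.62) p. 1076] -/
theorem srwEnvIM_spAct (m l : ℕ) (τ : SgnPermPair d) (x : Fin d → ℤ) :
    srwEnvIM d afmin afmax m l (spAct τ x) = srwEnvIM d afmin afmax m l x := by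
  unfold srwEnvIM
  rw [srwJ_spAct, srwI_spAct, spInvariant_srwIShift2]

/-- The `IM` column of the alternative true tables is `W_d`-invariant in the node. [cite: FitznerVanDerHofstad2016NoBLE, §3.3.4 (3.35)–(3.38) p. 1071; §3.3.5 (3.64) p. 1076] -/
theorem srwTrueAlt_IM_spAct (m : ℤ) (l : ℕ) (τ : SgnPermPair d) (x : Fin d → ℤ) :
    (srwTrueAlt d afmin afmax).IM m l (spAct τ x) = (srwTrueAlt d afmin afmax).IM m l x := by
  rcases m with m | k
  · rw [Int.ofNat_eq_natCast, srwTrueAlt_IM_natCast, srwTrueAlt_IM_natCast, srwEnvIM_spAct, srwTrue_IM_natCast, srwTrue_IM_natCast,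
      srwJ_spAct, srwI_spAct, spInvariant_srwIShift2]
  · rw [srwTrueAlt_IM_negSucc, srwTrueAlt_IM_negSucc, srwTrue_IM_negOne, srwTrue_IM_negOne, srwI_spAct, srwI_spAct,
      spInvariant_srwIShift2]

/-- The alternative true tables frozen at `σx` and at `x` coincide. [cite: FitznerVanDerHofstad2016NoBLE, (3.35)–(3.38) p. 1071; (3.64) p. 1076] -/
theorem srwTrueAlt_frozenAt_spAct (τ : SgnPermPair d) (x : Fin d → ℤ) :
    (srwTrueAlt d afmin afmax).frozenAt (spAct τ x) = (srwTrueAlt d afmin afmax).frozenAt x := by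
  have hIM : ∀ (m : ℤ) (l : ℕ), (srwTrueAlt d afmin afmax).IM m l (spAct τ x) = (srwTrueAlt d afmin afmax).IM m l x :=
    fun m l => srwTrueAlt_IM_spAct m l τ x
  simp only [Tables.frozenAt, hIM, srwTrueAlt_T, srwTrueAlt_U, srwTrueAlt_K, srwTS_spAct, srwU_spAct, srwK_spAct]

/-- **`boundHD75` at the alternative true tables is `W_d`-invariant in the node.** [cite: FitznerVanDerHofstad2016NoBLE, §3.3.5 (3.71)–(3.87); (3.35)–(3.38) p. 1071] -/
theorem boundHD75_srwTrueAlt_spAct (n l : ℕ) (τ : SgnPermPair d) (x : Fin d → ℤ) (a : Args) :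
    boundHD75 (srwTrueAlt d afmin afmax) n l (spAct τ x) a = boundHD75 (srwTrueAlt d afmin afmax) n l x a := by
  rw [boundHD75_eq_frozenAt (srwTrueAlt d afmin afmax) (v := spAct τ x), boundHD75_eq_frozenAt (srwTrueAlt d afmin afmax) (v := x),
    srwTrueAlt_frozenAt_spAct]
  rfl

/-- `x ↦ boundHD75 (srwTrueAlt d α̲ ᾱ) n l x a` is `W_d`-invariant. [cite: FitznerVanDerHofstad2016NoBLE, §3.3.5 (3.71)–(3.87); (3.35)–(3.38)] -/
theorem spInvariant_boundHD75_srwTrueAlt (n l : ℕ) (a : Args) :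
    SpInvariant (fun x => boundHD75 (srwTrueAlt d afmin afmax) n l x a) := fun τ x => boundHD75_srwTrueAlt_spAct n l τ x a

/-! ### §2  The shell pointwise and the split of `𝒳` -/

/-- **The shell `‖x‖₁ = 2` POINTWISE** at the alternative true tables: the cell inequality on the shell from its two values at `2e₁` and `e₁+e₂`.
[cite: FitznerVanDerHofstad2016NoBLE, §3.3.5 (3.87) p. 1079] [cite: FitznerVanDerHofstad2017, §2.5, notebook Percolation.nb (points `‖x‖₁ ≤ 2` of `𝒳`)] -/
theorem boundHD75_srwTrueAlt_shell_le (hd : 2 ≤ d) {n l : ℕ} {a : Args} {b : ℝ}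
    (h2 : boundHD75 (srwTrueAlt d afmin afmax) n l (vecOfParts d [2]) a ≤ b)
    (h11 : boundHD75 (srwTrueAlt d afmin afmax) n l (classVec d 2 0) a ≤ b) :
    ∀ x : Fin d → ℤ, ∑ j, |x j| = 2 → boundHD75 (srwTrueAlt d afmin afmax) n l x a ≤ b := fun _ hx =>
  le_of_sum_abs_eq_two (spInvariant_boundHD75_srwTrueAlt n l a) hd h2 h11 hx

/-- **The cell over `𝒳` from the two near values and the far cell `Q`** at the alternative true tables.
[cite: FitznerVanDerHofstad2016NoBLE, §3.3.5 (3.87) p. 1079; §5.1 p. 1093] [cite: FitznerVanDerHofstad2017, §2.5, notebook Percolation.nb] -/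
theorem boundHD75_srwTrueAlt_calX_le_of_nodes_of_Q (hd : 2 ≤ d) {n l : ℕ} {a : Args} {b : ℝ}
    (h2 : boundHD75 (srwTrueAlt d afmin afmax) n l (vecOfParts d [2]) a ≤ b)
    (h11 : boundHD75 (srwTrueAlt d afmin afmax) n l (classVec d 2 0) a ≤ b)
    (hQ : ∀ x : Fin d → ℤ, 3 ≤ ∑ j, |x j| → boundHD75 (srwTrueAlt d afmin afmax) n l x a ≤ b) :
    ∀ x ∈ calX d, boundHD75 (srwTrueAlt d afmin afmax) n l x a ≤ b :=
  forall_mem_calX_iff_shell_and_Q.mpr ⟨boundHD75_srwTrueAlt_shell_le hd h2 h11, hQ⟩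

/-! ### §3  Generic-cell and at-a-node forms under the alternative -/

/-- **Per-entry domination ON A SET `C` under the alternative** (natural row `m`, column `l`, literal `t`): EITHER print's three entrywise
sup hypotheses on `C` (`𝒥_{m+2,l} ≤ t`, `I_{m+3,l} ≤ dα̲·t`, `(ᾱ−1)·S_{m+3,l} ≤ 2d²·t`, tail-g11's shapes) OR majorants `J'`, `I'`, `S'` of
`𝒥_{m+2,l}`, `I_{m+3,l}`, `S_{m+3,l}` on `C` with the single corrected inequality `env d J' I' S' α̲ ᾱ 1 2 ≤ t`.
[cite: FitznerVanDerHofstad2016NoBLE, §3.3.5 (3.61)–(3.64) pp. 1074–1076; p. 1079] -/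
def OnDomAlt (d : ℕ) (afmin afmax : ℝ) (C : Set (Fin d → ℤ)) (m l : ℕ) (t : ℝ) : Prop :=
  ((∀ x ∈ C, srwJ d (m + 2) l x ≤ t) ∧ (∀ x ∈ C, srwI d (m + 3) l x ≤ d * afmin * t) ∧
      (∀ x ∈ C, (afmax - 1) * srwIShift2 d (m + 3) l x ≤ 2 * (d : ℝ) ^ 2 * t)) ∨
    ∃ J' I' S' : ℝ, (∀ x ∈ C, srwJ d (m + 2) l x ≤ J') ∧ (∀ x ∈ C, srwI d (m + 3) l x ≤ I') ∧
      (∀ x ∈ C, srwIShift2 d (m + 3) l x ≤ S') ∧ H1SlotD80.env d J' I' S' afmin afmax 1 2 ≤ t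

/-- Print's branch of `OnDomAlt` (tail-g11's three entrywise sup hypotheses). [cite: FitznerVanDerHofstad2016NoBLE, §3.3.5 (3.64) p. 1076; p. 1079] -/
theorem onDomAlt_of_printed {C : Set (Fin d → ℤ)} {m l : ℕ} {t : ℝ}
    (hJ : ∀ x ∈ C, srwJ d (m + 2) l x ≤ t) (hI : ∀ x ∈ C, srwI d (m + 3) l x ≤ d * afmin * t)
    (hS : ∀ x ∈ C, (afmax - 1) * srwIShift2 d (m + 3) l x ≤ 2 * (d : ℝ) ^ 2 * t) :
    OnDomAlt d afmin afmax C m l t :=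
  Or.inl ⟨hJ, hI, hS⟩

/-- The corrected branch of `OnDomAlt`: majorants on `C` and ONE inequality on the corrected majorant.
[cite: FitznerVanDerHofstad2016NoBLE, §3.3.5 (3.61)–(3.62), (3.64) p. 1076; p. 1079] -/
theorem onDomAlt_of_env_le {C : Set (Fin d → ℤ)} {m l : ℕ} {t J' I' S' : ℝ}
    (hJ : ∀ x ∈ C, srwJ d (m + 2) l x ≤ J') (hI : ∀ x ∈ C, srwI d (m + 3) l x ≤ I')
    (hS : ∀ x ∈ C, srwIShift2 d (m + 3) l x ≤ S') (h : H1SlotD80.env d J' I' S' afmin afmax 1 2 ≤ t) :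
    OnDomAlt d afmin afmax C m l t :=
  Or.inr ⟨J', I', S', hJ, hI, hS, h⟩

/-- `OnDomAlt` is antitone in the set. [cite: FitznerVanDerHofstad2016NoBLE, §3.3.5 (3.64) p. 1076] -/
theorem OnDomAlt.mono {C C' : Set (Fin d → ℤ)} {m l : ℕ} {t : ℝ} (h : OnDomAlt d afmin afmax C m l t) (hC : C' ⊆ C) :
    OnDomAlt d afmin afmax C' m l t := by
  rcases h with ⟨hJ, hI, hS⟩ | ⟨J', I', S', hJ, hI, hS, h⟩
  · exact Or.inl ⟨fun x hx => hJ x (hC hx), fun x hx => hI x (hC hx), fun x hx => hS x (hC hx)⟩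
  · exact Or.inr ⟨J', I', S', fun x hx => hJ x (hC hx), fun x hx => hI x (hC hx), fun x hx => hS x (hC hx), h⟩

/-- **One natural-row entry of the ALTERNATIVE true tables on `C` from `OnDomAlt`** (`d ≥ 1`, `0 < α̲`, `1 ≤ ᾱ`).
[cite: FitznerVanDerHofstad2016NoBLE, §3.3.5 (3.61)–(3.64) pp. 1074–1076; p. 1079] -/
theorem srwTrueAlt_IM_natCast_le_of_onDomAlt (hd : 1 ≤ d) (hα : 0 < afmin) (hᾱ : 1 ≤ afmax) {C : Set (Fin d → ℤ)} {m l : ℕ}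
    {t : ℝ} (h : OnDomAlt d afmin afmax C m l t) {x : Fin d → ℤ} (hx : x ∈ C) : (srwTrueAlt d afmin afmax).IM m l x ≤ t := by
  rcases h with ⟨hJ, hI, hS⟩ | ⟨J', I', S', hJ, hI, hS, h⟩
  · exact srwTrueAlt_IM_natCast_le_of_printed hd hα (hJ x hx) (hI x hx) (hS x hx)
  · have hdpos : (0 : ℝ) < d := Nat.cast_pos.mpr (by omega)
    exact srwTrueAlt_IM_natCast_le_of_env_le ((H1SlotD80.env_mono 1 2 hdpos hα hᾱ (hJ x hx) (hI x hx) (hS x hx)).trans h)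

/-- **Cell `(0,l)` over an arbitrary set `C` at the ALTERNATIVE true tables** from one `OnDomAlt` per read natural-row entry, print's
entrywise `m = −1` pair over `C`, the sups over `C` of `T^{(5.11)}` (`srwTS d α̲`), `U`, `K` at the read entries, and
`boundHD75 (Tables.cell IMc Tc Uc Kc) 0 l 0 a ≤ b` (twin of `boundHD75_srwTrue_zero_le_on`).
[cite: FitznerVanDerHofstad2016NoBLE, §3.3.5 (3.87) p. 1079; (3.71)–(3.86)] -/
theorem boundHD75_srwTrueAlt_zero_le_on (hd : 1 ≤ d) (hα : 0 < afmin) (hᾱ : 1 ≤ afmax) {a : Args} (ha : a.WF) (C : Set (Fin d → ℤ))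
    {IMc : ℤ → ℕ → ℝ} {Tc Uc Kc : ℕ → ℕ → ℝ} {l : ℕ} {b : ℝ}
    (hE0 : OnDomAlt d afmin afmax C 0 l (IMc 0 l)) (hE0' : OnDomAlt d afmin afmax C 0 (l + 1) (IMc 0 (l + 1)))
    (hN1 : ∀ x ∈ C, srwI d 1 (l + 1) x + srwIShift2 d 2 l x / (2 * (d : ℝ) ^ 2 * afmin) ≤ IMc (-1) l)
    (hN2 : ∀ x ∈ C, srwI d 2 l x ≤ d * afmin * IMc (-1) l)
    (hT2 : ∀ x ∈ C, srwTS d afmin 2 l x ≤ Tc 2 l) (hT2' : ∀ x ∈ C, srwTS d afmin 2 (l + 1) x ≤ Tc 2 (l + 1))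
    (hT1 : ∀ x ∈ C, srwTS d afmin 1 l x ≤ Tc 1 l)
    (hU2 : ∀ x ∈ C, srwU d 2 l x ≤ Uc 2 l) (hU3 : ∀ x ∈ C, srwU d 3 l x ≤ Uc 3 l)
    (hK1 : ∀ x ∈ C, srwK d 1 l x ≤ Kc 1 l) (hK2 : ∀ x ∈ C, srwK d 2 l x ≤ Kc 2 l)
    (hnum : boundHD75 (Tables.cell IMc Tc Uc Kc : Tables (Fin d → ℤ)) 0 l 0 a ≤ b) :
    ∀ x ∈ C, boundHD75 (srwTrueAlt d afmin afmax) 0 l x a ≤ b := by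
  intro x hx
  refine le_trans ?_ ((boundHD75_cell_irrel IMc Tc Uc Kc 0 l x 0 a).le.trans hnum)
  have hneg : (srwTrueAlt d afmin afmax).IM (-1) l x ≤ IMc (-1) l := by
    rw [srwTrueAlt_IM_negOne]; exact srwTrue_IM_negOne_le hd hα (hN1 x hx) (hN2 x hx)
  exact boundHD75_zero_le_of_entries ha
    (srwTrueAlt_IM_natCast_le_of_onDomAlt hd hα hᾱ hE0 hx) (srwTrueAlt_IM_natCast_le_of_onDomAlt hd hα hᾱ hE0' hx)
    hneg (hT2 x hx) (hT2' x hx) (hT1 x hx) (hU2 x hx) (hU3 x hx) (hK1 x hx) (hK2 x hx)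

/-- **Cells `(1,l)` over an arbitrary set `C` at the ALTERNATIVE true tables** from one `OnDomAlt` per read natural-row entry `(1,l)`, `(0,l)`,
`(1,l+1)`, `(0,l+1)`, `(1,l+2)`, the sups over `C` of `T^{(5.11)}`, `U`, `K`, and `boundHD75 (Tables.cell IMc Tc Uc Kc) 1 l 0 a ≤ b`
(twin of `boundHD75_srwTrue_one_le_on`). [cite: FitznerVanDerHofstad2016NoBLE, §3.3.5 (3.87) p. 1079; (3.71)–(3.86)] -/
theorem boundHD75_srwTrueAlt_one_le_on (hd : 1 ≤ d) (hα : 0 < afmin) (hᾱ : 1 ≤ afmax) {a : Args} (ha : a.WF) (C : Set (Fin d → ℤ))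
    {IMc : ℤ → ℕ → ℝ} {Tc Uc Kc : ℕ → ℕ → ℝ} {l : ℕ} {b : ℝ}
    (hE1 : OnDomAlt d afmin afmax C 1 l (IMc 1 l)) (hE0 : OnDomAlt d afmin afmax C 0 l (IMc 0 l))
    (hE1' : OnDomAlt d afmin afmax C 1 (l + 1) (IMc 1 (l + 1))) (hE0' : OnDomAlt d afmin afmax C 0 (l + 1) (IMc 0 (l + 1)))
    (hE1'' : OnDomAlt d afmin afmax C 1 (l + 2) (IMc 1 (l + 2)))
    (hT3 : ∀ x ∈ C, srwTS d afmin 3 l x ≤ Tc 3 l) (hT3' : ∀ x ∈ C, srwTS d afmin 3 (l + 1) x ≤ Tc 3 (l + 1))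
    (hT2 : ∀ x ∈ C, srwTS d afmin 2 l x ≤ Tc 2 l)
    (hU3 : ∀ x ∈ C, srwU d 3 l x ≤ Uc 3 l) (hU4 : ∀ x ∈ C, srwU d 4 l x ≤ Uc 4 l)
    (hK2 : ∀ x ∈ C, srwK d 2 l x ≤ Kc 2 l) (hK3 : ∀ x ∈ C, srwK d 3 l x ≤ Kc 3 l)
    (hnum : boundHD75 (Tables.cell IMc Tc Uc Kc : Tables (Fin d → ℤ)) 1 l 0 a ≤ b) :
    ∀ x ∈ C, boundHD75 (srwTrueAlt d afmin afmax) 1 l x a ≤ b := by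
  intro x hx
  refine le_trans ?_ ((boundHD75_cell_irrel IMc Tc Uc Kc 1 l x 0 a).le.trans hnum)
  exact boundHD75_one_le_of_entries ha
    (srwTrueAlt_IM_natCast_le_of_onDomAlt hd hα hᾱ hE1 hx) (srwTrueAlt_IM_natCast_le_of_onDomAlt hd hα hᾱ hE0 hx)
    (srwTrueAlt_IM_natCast_le_of_onDomAlt hd hα hᾱ hE1' hx) (srwTrueAlt_IM_natCast_le_of_onDomAlt hd hα hᾱ hE0' hx)
    (srwTrueAlt_IM_natCast_le_of_onDomAlt hd hα hᾱ hE1'' hx)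
    (hT3 x hx) (hT3' x hx) (hT2 x hx) (hU3 x hx) (hU4 x hx) (hK2 x hx) (hK3 x hx)

/-- **Cell `(0,l)` AT ONE NODE `y` at the ALTERNATIVE true tables** from the `IM` entry values at `y` (natural rows: feed
`srwTrueAlt_IM_natCast_le_of_printed` / `…_of_env_le`; row `−1`: print's pair), the `T`/`U`/`K` values at `y`, and the constant-table
inequality (twin of `boundHD75_srwTrue_zero_at_le`). [cite: FitznerVanDerHofstad2016NoBLE, §3.3.5 (3.87) p. 1079; (3.71)–(3.86)] [cite: FitznerVanDerHofstad2017, §2.5, notebook Percolation.nb] -/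
theorem boundHD75_srwTrueAlt_zero_at_le (hd : 1 ≤ d) (hα : 0 < afmin) {a : Args} (ha : a.WF) (y : Fin d → ℤ)
    {IMc : ℤ → ℕ → ℝ} {Tc Uc Kc : ℕ → ℕ → ℝ} {l : ℕ} {b : ℝ}
    (hE0 : (srwTrueAlt d afmin afmax).IM 0 l y ≤ IMc 0 l) (hE0' : (srwTrueAlt d afmin afmax).IM 0 (l + 1) y ≤ IMc 0 (l + 1))
    (hN1 : srwI d 1 (l + 1) y + srwIShift2 d 2 l y / (2 * (d : ℝ) ^ 2 * afmin) ≤ IMc (-1) l)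
    (hN2 : srwI d 2 l y ≤ d * afmin * IMc (-1) l)
    (hT2 : srwTS d afmin 2 l y ≤ Tc 2 l) (hT2' : srwTS d afmin 2 (l + 1) y ≤ Tc 2 (l + 1)) (hT1 : srwTS d afmin 1 l y ≤ Tc 1 l)
    (hU2 : srwU d 2 l y ≤ Uc 2 l) (hU3 : srwU d 3 l y ≤ Uc 3 l) (hK1 : srwK d 1 l y ≤ Kc 1 l) (hK2 : srwK d 2 l y ≤ Kc 2 l)
    (hnum : boundHD75 (Tables.cell IMc Tc Uc Kc : Tables (Fin d → ℤ)) 0 l 0 a ≤ b) :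
    boundHD75 (srwTrueAlt d afmin afmax) 0 l y a ≤ b := by
  refine le_trans ?_ ((boundHD75_cell_irrel IMc Tc Uc Kc 0 l y 0 a).le.trans hnum)
  have hneg : (srwTrueAlt d afmin afmax).IM (-1) l y ≤ IMc (-1) l := by
    rw [srwTrueAlt_IM_negOne]; exact srwTrue_IM_negOne_le hd hα hN1 hN2
  exact boundHD75_zero_le_of_entries ha hE0 hE0' hneg hT2 hT2' hT1 hU2 hU3 hK1 hK2

/-- **Cells `(1,l)` AT ONE NODE `y` at the ALTERNATIVE true tables** from the natural-row `IM` entry values at `y`, the `T`/`U`/`K` values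
at `y`, and the constant-table inequality (twin of `boundHD75_srwTrue_one_at_le`).
[cite: FitznerVanDerHofstad2016NoBLE, §3.3.5 (3.87) p. 1079; (3.71)–(3.86)] [cite: FitznerVanDerHofstad2017, §2.5, notebook Percolation.nb] -/
theorem boundHD75_srwTrueAlt_one_at_le {a : Args} (ha : a.WF) (y : Fin d → ℤ)
    {IMc : ℤ → ℕ → ℝ} {Tc Uc Kc : ℕ → ℕ → ℝ} {l : ℕ} {b : ℝ}
    (hE1 : (srwTrueAlt d afmin afmax).IM 1 l y ≤ IMc 1 l) (hE0 : (srwTrueAlt d afmin afmax).IM 0 l y ≤ IMc 0 l)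
    (hE1' : (srwTrueAlt d afmin afmax).IM 1 (l + 1) y ≤ IMc 1 (l + 1)) (hE0' : (srwTrueAlt d afmin afmax).IM 0 (l + 1) y ≤ IMc 0 (l + 1))
    (hE1'' : (srwTrueAlt d afmin afmax).IM 1 (l + 2) y ≤ IMc 1 (l + 2))
    (hT3 : srwTS d afmin 3 l y ≤ Tc 3 l) (hT3' : srwTS d afmin 3 (l + 1) y ≤ Tc 3 (l + 1)) (hT2 : srwTS d afmin 2 l y ≤ Tc 2 l)
    (hU3 : srwU d 3 l y ≤ Uc 3 l) (hU4 : srwU d 4 l y ≤ Uc 4 l) (hK2 : srwK d 2 l y ≤ Kc 2 l) (hK3 : srwK d 3 l y ≤ Kc 3 l)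
    (hnum : boundHD75 (Tables.cell IMc Tc Uc Kc : Tables (Fin d → ℤ)) 1 l 0 a ≤ b) :
    boundHD75 (srwTrueAlt d afmin afmax) 1 l y a ≤ b := by
  refine le_trans ?_ ((boundHD75_cell_irrel IMc Tc Uc Kc 1 l y 0 a).le.trans hnum)
  exact boundHD75_one_le_of_entries ha hE1 hE0 hE1' hE0' hE1'' hT3 hT3' hT2 hU3 hU4 hK2 hK3

/-! ### §4  The per-cone reading on `Q` and on `𝒳` -/

/-- **Three cone bounds ⇒ the cell bound on all of `Q = {‖x‖₁ ≥ 3}`** at the ALTERNATIVE true tables (the shape of the hypotheses `h0Q`, `h1Q`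
of `nobleWeightedDiagramBoundAt_of_witness_srwTrueAlt_smallX`): cone cover + `W_d`-invariance `boundHD75_srwTrueAlt_spAct`.
[cite: FitznerVanDerHofstad2016NoBLE, §3.3.5 (3.87) p. 1079; §5.1 p. 1093] [cite: FitznerVanDerHofstad2017, §2.5, notebook Percolation.nb (`boundF3[2,o]`, `boundF3[3,o]`: `BoundFThreeBound[n,l,{{3},{1,1},{0,0,1}}]`)] -/
theorem boundHD75_srwTrueAlt_three_le_of_absCones (hd : 3 ≤ d) {n l : ℕ} {a : Args} {b : ℝ}
    (h3 : ∀ x ∈ absCone (vecOfParts d [3]), boundHD75 (srwTrueAlt d afmin afmax) n l x a ≤ b)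
    (h21 : ∀ x ∈ absCone (vecOfParts d [2, 1]), boundHD75 (srwTrueAlt d afmin afmax) n l x a ≤ b)
    (h111 : ∀ x ∈ absCone (vecOfParts d [1, 1, 1]), boundHD75 (srwTrueAlt d afmin afmax) n l x a ≤ b) :
    ∀ x : Fin d → ℤ, 3 ≤ ∑ j, |x j| → boundHD75 (srwTrueAlt d afmin afmax) n l x a ≤ b :=
  forall_three_le_of_absCones hd (P := fun x => boundHD75 (srwTrueAlt d afmin afmax) n l x a ≤ b)
    (fun τ x h => by rwa [boundHD75_srwTrueAlt_spAct] at h) h3 h21 h111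

/-- The same as an equivalence: the cell bound on `Q` IS the conjunction of the three cone bounds, alternative true tables.
[cite: FitznerVanDerHofstad2016NoBLE, §3.3.5 (3.87) p. 1079; §5.1 p. 1093] -/
theorem boundHD75_srwTrueAlt_three_le_iff_absCones (hd : 3 ≤ d) {n l : ℕ} {a : Args} {b : ℝ} :
    (∀ x : Fin d → ℤ, 3 ≤ ∑ j, |x j| → boundHD75 (srwTrueAlt d afmin afmax) n l x a ≤ b) ↔
      (∀ x ∈ absCone (vecOfParts d [3]), boundHD75 (srwTrueAlt d afmin afmax) n l x a ≤ b) ∧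
        (∀ x ∈ absCone (vecOfParts d [2, 1]), boundHD75 (srwTrueAlt d afmin afmax) n l x a ≤ b) ∧
          (∀ x ∈ absCone (vecOfParts d [1, 1, 1]), boundHD75 (srwTrueAlt d afmin afmax) n l x a ≤ b) :=
  forall_three_le_iff_absCones hd (P := fun x => boundHD75 (srwTrueAlt d afmin afmax) n l x a ≤ b)
    fun τ x h => by rwa [boundHD75_srwTrueAlt_spAct] at h

/-- **Shell nodes + three cones ⇒ the cell bound on all of `𝒳 = {‖x‖₁ ≥ 2}`** at the ALTERNATIVE true tables (cells `(1,1)`, `(1,2)`, `(1,3)`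
in the per-cone reading). [cite: FitznerVanDerHofstad2016NoBLE, §3.3.5 (3.87) p. 1079; §5.1 p. 1093] [cite: FitznerVanDerHofstad2017, (2.21)–(2.23); §2.5, notebook Percolation.nb (`boundF3[4,o]`–`boundF3[6,o]`)] -/
theorem boundHD75_srwTrueAlt_calX_le_of_nodes_of_absCones (hd : 3 ≤ d) {n l : ℕ} {a : Args} {b : ℝ}
    (h2 : boundHD75 (srwTrueAlt d afmin afmax) n l (vecOfParts d [2]) a ≤ b)
    (h11 : boundHD75 (srwTrueAlt d afmin afmax) n l (classVec d 2 0) a ≤ b)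
    (h3 : ∀ x ∈ absCone (vecOfParts d [3]), boundHD75 (srwTrueAlt d afmin afmax) n l x a ≤ b)
    (h21 : ∀ x ∈ absCone (vecOfParts d [2, 1]), boundHD75 (srwTrueAlt d afmin afmax) n l x a ≤ b)
    (h111 : ∀ x ∈ absCone (vecOfParts d [1, 1, 1]), boundHD75 (srwTrueAlt d afmin afmax) n l x a ≤ b) :
    ∀ x ∈ calX d, boundHD75 (srwTrueAlt d afmin afmax) n l x a ≤ b :=
  boundHD75_srwTrueAlt_calX_le_of_nodes_of_Q (by omega) h2 h11 (boundHD75_srwTrueAlt_three_le_of_absCones hd h3 h21 h111)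

end F3Bounds

end Literature.Probability.FitznerVanDerHofstad2017

end
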